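import Literature.Probability.Percolation.TwoSetConditionalAssociationRC
import Literature.Probability.Percolation.PercolationEvents
import Mathlib.Tactic.Linarith
import HarnessLib

/-!
# Cross-Harris at a terminal for the random-cluster measure `φ_{𝐩,q}`, `q ≥ 1`: un-wiring a terminal

Support file for `stmt-CriticalPhenomena-4575` (memo `prim-gen-kcluster/KCLUSTER-gen67.md` §1; prover
prim-gen-kcluster gen 67).  No named facts, no sorries, no new definitions.  It settles, for every `q ≥ 1`
and ALL pairs of boundary laws, the question left open at `q > 1` by
`…LowerTailCrossHarrisTerminal.lean` (gen 66, `q = 1`): lead (B′) of `KCLUSTER-gen66.md` §3.7/§8.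

SETTING.  `V` a finite vertex type, `φ_{w,q} = rcMeasureW w q ∅` the (free) random-cluster measure with
edge parameters `w : Sym2 V → [0,1]` and cluster weight `q` (Grimmett 2006 (1.20); the tree's
`RandomClusterEdgeWeights.lean`), three vertices `a` (apex), `b` (the *terminal*), `c`, and TWO parameter
vectors `w₁, w₂` which AGREE ON EVERY PAIR NOT CONTAINING `b` — two arbitrary "boundary laws" for the star
of `b` over the same graph `K = G − b` (the pinnings `w_i(bx) ∈ {0,1}` are the two patterns `X, X'` of
gen 66; parameter `1` on `bx` = `x` wired to `b`).

**Theorem (`crossHarris_terminal_rc`).**  For `q ≥ 1`,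
`φ_{w₁}(a↔b)·φ_{w₂}(a↔c) + φ_{w₂}(a↔b)·φ_{w₁}(a↔c) ≤ φ_{w₁}(a↔b, a↔c) + φ_{w₂}(a↔b, a↔c)`:
the polar form of the Harris slack `φ(a↔b↔c) − φ(a↔b)φ(a↔c)` between ANY two boundary laws at a
terminal is non-negative (the diagonal `w₁ = w₂` is Harris/FKG).  Hence (`harris_terminal_potential_rc`)
the Harris inequality for `{a↔b}, {a↔c}` survives an arbitrary non-negative re-weighting of the star of
`b`, for every `q ≥ 1`; and (`crossHarris_terminal_rc_sharp`) the sharp form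
`CH ≥ Har(w₁)` whenever `φ_{w₁}(a↔b) ≥ φ_{w₂}(a↔b)`, conjectured in gen 66 (`CH ≥ min(Har₁, Har₂)`).

**Mechanism (`unwire`, the whole content).**  If `w₁ ≤ w₂` off the star of `b` (anything at `b`), then
`φ_{w₁}(a ↮ b, a ↔ c) ≤ φ_{w₁}(a ↮ b) · φ_{w₂}(a ↔ c)`:
conditionally on NOT being joined to the terminal, the apex cluster forgets the boundary law at `b`.
Proof: condition on the open cluster `C_b = W` (vdBHK Lemma 2.3/2.4 for `φ_{𝐩,q}`, the tree's
`BHK2006.rc_set_sum_cond_cluster`: off `W̄` the law is `φ` on `G − W̄`, and on `{a ↮ b}` the cluster of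
`a` lives off `W̄`); `G − W̄` has lost every pair at `b`, so its parameters are `≤ w₂`, and `{a ↔ c}` is
increasing (comparison in `𝐩`, Grimmett Thm (3.21), the tree's `sum_rcMass_mono_weights`).  Then
`CH = [φ_{w₂}(a↔c)·φ_{w₁}(a↮b) − φ_{w₁}(a↮b, a↔c)] + [1 ↔ 2] ≥ 0` — no four-point decomposition is
needed (gen 66 §3.7 recorded FKG/Holley/Ahlswede–Daykin as insufficient: the missing input is the
domain Markov property).  [this work]
[cite: VandenbergHaggstromKahn2005, §2.1 Lemmas 2.3–2.4 (p. 10)] [cite: Grimmett2006, Thm. (3.21) (p. 43); Thm. (3.8)]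
-/

noncomputable section

namespace Summit.CriticalPhenomena.PercolationContinuityZ3.Theorems

namespace CrossHarrisRC

open MeasureTheory Literature.Probability.Percolation Literature.Probability.LatticeModels
open Literature.Probability.Percolation.BHK2006
open Literature.Probability.Percolation.DecisionTree (ind ind_of_mem ind_of_not_mem ind_nonneg)
open scoped Classical

variable {V : Type*} [Fintype V]

omit [Fintype V] in
/-- Deleting the pairs meeting `{b} ∪ V(W)` kills every pair at `b`; off the star of `b` it only lowers
the parameters.  So `w₁ ≤ w₂` off the star of `b` gives `(w₁)_{G − W̄} ≤ w₂` everywhere. [this work] -/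
theorem delW_barOf_le {w₁ w₂ : Sym2 V → unitInterval} {b : V}
    (h : ∀ e : Sym2 V, b ∉ e → w₁ e ≤ w₂ e) (W : Set (Sym2 V)) (e : Sym2 V) :
    delW w₁ (barOf {b} W) e ≤ w₂ e := by
  unfold delW
  split_ifs with he
  · exact unitInterval.nonneg'
  · exact h e fun hb => he (mem_barOf_of_mem (Set.mem_singleton b) hb W)

omit [Fintype V] in
/-- `{a ↔ c}` read off the open edge cluster of `{a}`. [folklore] -/
theorem reachable_iff_setCl_singleton (ω : BondConfig V) (a c : V) :
    (openGraph ω).Reachable a c ↔ c ∈ ({a} : Set V) ∨ ∃ e ∈ setCl ω {a}, c ∈ e := by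
  rw [← setReach_iff]
  simp only [Set.mem_singleton_iff, exists_eq_left]

omit [Fintype V] in
/-- The real indicator of an increasing event is monotone. [folklore] -/
theorem ind_mono_of_isUpperSet {A : Set (BondConfig V)} (hA : IsUpperSet A) : Monotone (ind A) := by
  intro ω ω' hle
  by_cases hω : ω ∈ A
  · rw [ind_of_mem hω, ind_of_mem (hA hle hω)]
  · rw [ind_of_not_mem hω]
    exact ind_nonneg A ω'

/-- **Un-wiring a terminal.**  `q ≥ 1`; `w₁ ≤ w₂` on the pairs not containing `b` (the pairs at `b`
arbitrary in both).  Then `φ_{w₁,q}(a ↮ b, a ↔ c) ≤ φ_{w₁,q}(a ↮ b) · φ_{w₂,q}(a ↔ c)`: given that the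
apex is not joined to the terminal `b`, the probability that it is joined to `c` is at most its
probability under ANY boundary law at `b` over parameters at least `w₁` elsewhere.  (Domain Markov
given `C_b` + comparison in `𝐩`.) [this work] -/
theorem unwire {q : ℝ} (hq : 1 ≤ q) {w₁ w₂ : Sym2 V → unitInterval} {b : V}
    (h : ∀ e : Sym2 V, b ∉ e → w₁ e ≤ w₂ e) (a c : V) :
    (rcMeasureW w₁ q ∅).real ((openConn a c : Set (BondConfig V)) \ openConn a b) ≤
      (rcMeasureW w₁ q ∅).real (openConn a b : Set (BondConfig V))ᶜ *
        (rcMeasureW w₂ q ∅).real (openConn a c : Set (BondConfig V)) := by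
  have hq0 : 0 < q := one_pos.trans_le hq
  set C : Set (BondConfig V) := openConn a c with hCdef
  set D : Set (BondConfig V) := (openConn a b : Set (BondConfig V))ᶜ with hDdef
  have hD : ∀ ω, ω ∈ D ↔ ∀ s ∈ ({b} : Set V), ∀ t ∈ ({a} : Set V), ¬ (openGraph ω).Reachable s t := by
    intro ω
    simp only [hDdef, Set.mem_compl_iff, openConn, Set.mem_setOf_eq, Set.mem_singleton_iff,
      forall_eq]
    exact ⟨fun hn hba => hn hba.symm, fun hn hab => hn hab.symm⟩
  -- `{a ↔ c}` as a function of the cluster of `{a}`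
  set H : Set (Sym2 V) → Set (Sym2 V) → ℝ := fun _ W' =>
    if (c ∈ ({a} : Set V) ∨ ∃ e ∈ W', c ∈ e) then 1 else 0 with hHdef
  have hH' : ∀ (W : Set (Sym2 V)) (η : BondConfig V), H W (setCl η {a}) = ind C η := by
    intro W η
    by_cases hη : η ∈ C
    · rw [ind_of_mem hη]
      exact if_pos ((reachable_iff_setCl_singleton η a c).1 hη)
    · rw [ind_of_not_mem hη]
      exact if_neg fun h' => hη ((reachable_iff_setCl_singleton η a c).2 h')
  have hCD : C \ (openConn a b : Set (BondConfig V)) = C ∩ D := by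
    ext ω
    simp only [Set.mem_sdiff, Set.mem_inter_iff, hDdef, Set.mem_compl_iff]
  -- vdBHK Lemma 2.3/2.4: condition on `C_b`
  have key := rc_set_sum_cond_cluster w₁ hq0 {b} {a} H hD
  -- the conditional probability of `{a ↔ c}` is at most `φ_{w₂}(a ↔ c)`
  set γ₂ : ℝ := (rcMeasureW w₂ q ∅).real C with hγ₂
  have hγ₂sum : γ₂ = ∑ η, rcMass w₂ q η * ind C η := rcMeasureW_real_eq_sum_rcMass w₂ hq0 C
  have hmono : Monotone (ind C) := ind_mono_of_isUpperSet (isUpperSet_openConn a c)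
  have hinner : ∀ ω : BondConfig V,
      ∑ η, rcMass (delW w₁ (barOf {b} (setCl ω {b}))) q η * H (setCl ω {b}) (setCl η {a}) ≤ γ₂ := by
    intro ω
    simp only [hH']
    rw [hγ₂sum]
    exact sum_rcMass_mono_weights (delW_barOf_le h (setCl ω {b})) hq hmono
  -- the two sides as measures
  have hL : (rcMeasureW w₁ q ∅).real (C \ openConn a b) =
      ∑ ω, rcMass w₁ q ω * (H (setCl ω {b}) (setCl ω {a}) * ind D ω) := by
    rw [hCD, rcMeasureW_real_eq_sum_rcMass w₁ hq0]
    refine Finset.sum_congr rfl fun ω _ => ?_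
    rw [hH' (setCl ω {b}) ω, ind_inter]
  have hR : (rcMeasureW w₁ q ∅).real D = ∑ ω, rcMass w₁ q ω * ind D ω :=
    rcMeasureW_real_eq_sum_rcMass w₁ hq0 D
  rw [hL, key, hR, Finset.sum_mul]
  refine Finset.sum_le_sum fun ω _ => ?_
  have hm : 0 ≤ rcMass w₁ q ω := rcMass_nonneg w₁ hq0 ω
  have hi : 0 ≤ ind D ω := ind_nonneg D ω
  calc rcMass w₁ q ω * ((∑ η, rcMass (delW w₁ (barOf {b} (setCl ω {b}))) q η *
          H (setCl ω {b}) (setCl η {a})) * ind D ω)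
      ≤ rcMass w₁ q ω * (γ₂ * ind D ω) :=
        mul_le_mul_of_nonneg_left (mul_le_mul_of_nonneg_right (hinner ω) hi) hm
    _ = rcMass w₁ q ω * ind D ω * γ₂ := by ring

/-- **Cross-Harris at a terminal for `φ_{𝐩,q}`, `q ≥ 1`, all pairs of boundary laws.**  For two
parameter vectors `w₁, w₂` agreeing on every pair not containing the terminal `b`:
`φ_{w₁}(a↔b)·φ_{w₂}(a↔c) + φ_{w₂}(a↔b)·φ_{w₁}(a↔c) ≤ φ_{w₁}(a↔b ∧ a↔c) + φ_{w₂}(a↔b ∧ a↔c)`.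
For `w_i(b·) ∈ {0,1}` these are the pattern pairs `(X, X')` of gen 66 (every pair: nested, crossing,
exchange); `w₁ = w₂` is Harris. [this work] -/
theorem crossHarris_terminal_rc {q : ℝ} (hq : 1 ≤ q) {w₁ w₂ : Sym2 V → unitInterval} {b : V}
    (h : ∀ e : Sym2 V, b ∉ e → w₁ e = w₂ e) (a c : V) :
    (rcMeasureW w₁ q ∅).real (openConn a b : Set (BondConfig V)) *
        (rcMeasureW w₂ q ∅).real (openConn a c : Set (BondConfig V)) +
      (rcMeasureW w₂ q ∅).real (openConn a b : Set (BondConfig V)) *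
        (rcMeasureW w₁ q ∅).real (openConn a c : Set (BondConfig V)) ≤
      (rcMeasureW w₁ q ∅).real ((openConn a b : Set (BondConfig V)) ∩ openConn a c) +
        (rcMeasureW w₂ q ∅).real ((openConn a b : Set (BondConfig V)) ∩ openConn a c) := by
  have hq0 : 0 < q := one_pos.trans_le hq
  haveI := isProbabilityMeasure_rcMeasureW w₁ hq0 ∅
  haveI := isProbabilityMeasure_rcMeasureW w₂ hq0 ∅
  set μ₁ := rcMeasureW w₁ q ∅ with hμ₁
  set μ₂ := rcMeasureW w₂ q ∅ with hμ₂
  set B : Set (BondConfig V) := openConn a b with hB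
  set C : Set (BondConfig V) := openConn a c with hC
  have hmeas : MeasurableSet B := MeasurableSet.of_discrete
  have n1 := unwire hq (fun e he => (h e he).le) a c
  have n2 := unwire hq (fun e he => (h e he).symm.le) a c
  have c1 : μ₁.real Bᶜ = 1 - μ₁.real B := probReal_compl_eq_one_sub hmeas
  have c2 : μ₂.real Bᶜ = 1 - μ₂.real B := probReal_compl_eq_one_sub hmeas
  have s1 : μ₁.real (C ∩ B) + μ₁.real (C \ B) = μ₁.real C := measureReal_inter_add_sdiff hmeas
  have s2 : μ₂.real (C ∩ B) + μ₂.real (C \ B) = μ₂.real C := measureReal_inter_add_sdiff hmeas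
  rw [Set.inter_comm B C]
  rw [c1] at n1
  rw [c2] at n2
  nlinarith [n1, n2, s1, s2]

/-- **Sharp form.**  If `φ_{w₁}(a↔b) ≥ φ_{w₂}(a↔b)` then the cross term is at least the full Harris slack
of `w₁`: `φ_{w₁}(a↔b)φ_{w₂}(a↔c) + φ_{w₂}(a↔b)φ_{w₁}(a↔c) + [φ_{w₁}(a↔b,a↔c) − φ_{w₁}(a↔b)φ_{w₁}(a↔c)]
≤ φ_{w₁}(a↔b,a↔c) + φ_{w₂}(a↔b,a↔c)`; in particular `CH ≥ min(Har₁, Har₂)` always (gen 66's sharp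
conjecture, now a theorem for every `q ≥ 1`).  Proof: un-wire through the common sub-vector `w₀`
(`w₁` with the star of `b` deleted), whose `φ_{w₀}(a↔c)` is below both. [this work] -/
theorem crossHarris_terminal_rc_sharp {q : ℝ} (hq : 1 ≤ q) {w₁ w₂ : Sym2 V → unitInterval} {b : V}
    (h : ∀ e : Sym2 V, b ∉ e → w₁ e = w₂ e) (a c : V)
    (hβ : (rcMeasureW w₂ q ∅).real (openConn a b : Set (BondConfig V)) ≤
      (rcMeasureW w₁ q ∅).real (openConn a b : Set (BondConfig V))) :
    (rcMeasureW w₁ q ∅).real (openConn a b : Set (BondConfig V)) *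
        (rcMeasureW w₂ q ∅).real (openConn a c : Set (BondConfig V)) +
      (rcMeasureW w₂ q ∅).real (openConn a b : Set (BondConfig V)) *
        (rcMeasureW w₁ q ∅).real (openConn a c : Set (BondConfig V)) +
      ((rcMeasureW w₁ q ∅).real ((openConn a b : Set (BondConfig V)) ∩ openConn a c) -
        (rcMeasureW w₁ q ∅).real (openConn a b : Set (BondConfig V)) *
          (rcMeasureW w₁ q ∅).real (openConn a c : Set (BondConfig V))) ≤
      (rcMeasureW w₁ q ∅).real ((openConn a b : Set (BondConfig V)) ∩ openConn a c) +
        (rcMeasureW w₂ q ∅).real ((openConn a b : Set (BondConfig V)) ∩ openConn a c) := by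
  have hq0 : 0 < q := one_pos.trans_le hq
  haveI := isProbabilityMeasure_rcMeasureW w₁ hq0 ∅
  haveI := isProbabilityMeasure_rcMeasureW w₂ hq0 ∅
  -- the common sub-vector: the star of `b` deleted
  set w₀ : Sym2 V → unitInterval := delW w₁ {e | b ∈ e} with hw₀
  have h01 : ∀ e : Sym2 V, w₀ e ≤ w₁ e := fun e => delW_le w₁ _ e
  have h02 : ∀ e : Sym2 V, w₀ e ≤ w₂ e := by
    intro e
    by_cases he : b ∈ e
    · simp only [hw₀, delW, Set.mem_setOf_eq, he, if_true]; exact unitInterval.nonneg'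
    · exact (h01 e).trans (h e he).le
  have h20 : ∀ e : Sym2 V, b ∉ e → w₂ e ≤ w₀ e := by
    intro e he
    simp only [hw₀, delW, Set.mem_setOf_eq, he, if_false]
    exact (h e he).symm.le
  set μ₁ := rcMeasureW w₁ q ∅ with hμ₁
  set μ₂ := rcMeasureW w₂ q ∅ with hμ₂
  set B : Set (BondConfig V) := openConn a b with hB
  set C : Set (BondConfig V) := openConn a c with hC
  have hmeas : MeasurableSet B := MeasurableSet.of_discrete
  -- un-wire `w₂` through `w₀`
  have n2 := unwire hq h20 a c
  -- `φ_{w₀}(a↔c)` is below both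
  have k1 : (rcMeasureW w₀ q ∅).real C ≤ μ₁.real C :=
    rcMeasureW_real_mono_weights h01 hq ∅ (isUpperSet_openConn a c)
  have k2 : (rcMeasureW w₀ q ∅).real C ≤ μ₂.real C :=
    rcMeasureW_real_mono_weights h02 hq ∅ (isUpperSet_openConn a c)
  have k0 : 0 ≤ (rcMeasureW w₀ q ∅).real C := measureReal_nonneg
  have c2 : μ₂.real Bᶜ = 1 - μ₂.real B := probReal_compl_eq_one_sub hmeas
  have s2 : μ₂.real (C ∩ B) + μ₂.real (C \ B) = μ₂.real C := measureReal_inter_add_sdiff hmeas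
  have b1 : μ₁.real B ≤ 1 := measureReal_le_one
  have b2 : 0 ≤ μ₂.real B := measureReal_nonneg
  rw [Set.inter_comm B C]
  rw [c2] at n2
  nlinarith [n2, s2, k1, k2, k0, b1, b2, hβ, mul_nonneg (sub_nonneg.2 b1) (sub_nonneg.2 k2),
    mul_nonneg (sub_nonneg.2 hβ) (sub_nonneg.2 k1)]

/-- **Harris at a terminal survives an arbitrary non-negative potential on the star of the terminal,
`q ≥ 1`.**  For finitely many parameter vectors `w i` agreeing off the star of `b` and weights `ψ i ≥ 0`:
`(Σ ψ_i φ_{w_i}(a↔b)) · (Σ ψ_i φ_{w_i}(a↔c)) ≤ (Σ ψ_i φ_{w_i}(a↔b, a↔c)) · (Σ ψ_i)` — the cross matrix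
is entrywise non-negative, hence copositive. [this work] -/
theorem harris_terminal_potential_rc {q : ℝ} (hq : 1 ≤ q) {ι : Type*} (s : Finset ι)
    (w : ι → Sym2 V → unitInterval) {b : V} (h : ∀ i ∈ s, ∀ j ∈ s, ∀ e : Sym2 V, b ∉ e → w i e = w j e)
    (ψ : ι → ℝ) (hψ : ∀ i ∈ s, 0 ≤ ψ i) (a c : V) :
    (∑ i ∈ s, ψ i * (rcMeasureW (w i) q ∅).real (openConn a b : Set (BondConfig V))) *
        (∑ i ∈ s, ψ i * (rcMeasureW (w i) q ∅).real (openConn a c : Set (BondConfig V))) ≤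
      (∑ i ∈ s, ψ i * (rcMeasureW (w i) q ∅).real ((openConn a b : Set (BondConfig V)) ∩ openConn a c)) *
        (∑ i ∈ s, ψ i) := by
  rw [Finset.sum_mul_sum, Finset.sum_mul_sum]
  -- symmetrise: 2·LHS = Σ_{i,j} ψ_i ψ_j (β_i γ_j + β_j γ_i) ≤ Σ_{i,j} ψ_i ψ_j (α_i + α_j) = 2·RHS
  have key : ∀ i ∈ s, ∀ j ∈ s,
      ψ i * (rcMeasureW (w i) q ∅).real (openConn a b : Set (BondConfig V)) *
          (ψ j * (rcMeasureW (w j) q ∅).real (openConn a c : Set (BondConfig V))) +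
        ψ j * (rcMeasureW (w j) q ∅).real (openConn a b : Set (BondConfig V)) *
          (ψ i * (rcMeasureW (w i) q ∅).real (openConn a c : Set (BondConfig V))) ≤
      ψ i * (rcMeasureW (w i) q ∅).real ((openConn a b : Set (BondConfig V)) ∩ openConn a c) * ψ j +
        ψ j * (rcMeasureW (w j) q ∅).real ((openConn a b : Set (BondConfig V)) ∩ openConn a c) * ψ i := by
    intro i hi j hj
    have hx := crossHarris_terminal_rc hq (h i hi j hj) a c
    have hij : 0 ≤ ψ i * ψ j := mul_nonneg (hψ i hi) (hψ j hj)
    nlinarith [mul_le_mul_of_nonneg_left hx hij]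
  have hsum := Finset.sum_le_sum fun i hi => Finset.sum_le_sum fun j hj => key i hi j hj
  simp only [Finset.sum_add_distrib] at hsum
  rw [Finset.sum_comm (f := fun i j => ψ j * (rcMeasureW (w j) q ∅).real
      (openConn a b : Set (BondConfig V)) * (ψ i * (rcMeasureW (w i) q ∅).real
        (openConn a c : Set (BondConfig V))))] at hsum
  rw [Finset.sum_comm (f := fun i j => ψ j * (rcMeasureW (w j) q ∅).real
      ((openConn a b : Set (BondConfig V)) ∩ openConn a c) * ψ i)] at hsum
  linarith

/-! ### Appendix (gen 67, same session): the other event may be `{a ↔ S}` for a vertex SET `S`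

The un-wiring lemma holds for every increasing event measurable with respect to the cluster of `a`; here the
case `{C_a meets S} = ⋃ s ∈ S, {a ↔ s}` (e.g. `a` joined to a second GLUED terminal) — so both terminals of the
cross-Harris inequality may carry arbitrary boundary laws, one through the parameters at `b`, the other through `S`. -/

omit [Fintype V] in
/-- `{C_a meets S}` read off the open edge cluster of `{a}`. [folklore] -/
theorem reachSet_iff_setCl_singleton (ω : BondConfig V) (a : V) (S : Set V) :
    ω ∈ (⋃ s ∈ S, (openConn a s : Set (BondConfig V))) ↔
      ∃ s ∈ S, (s ∈ ({a} : Set V) ∨ ∃ e ∈ setCl ω {a}, s ∈ e) := by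
  simp only [Set.mem_iUnion, exists_prop]
  exact ⟨fun ⟨s, hs, h⟩ => ⟨s, hs, (reachable_iff_setCl_singleton ω a s).1 h⟩,
    fun ⟨s, hs, h⟩ => ⟨s, hs, (reachable_iff_setCl_singleton ω a s).2 h⟩⟩

/-- **Un-wiring a terminal, set form.**  `q ≥ 1`; `w₁ ≤ w₂` on the pairs not containing `b`.  Then
`φ_{w₁,q}(a ↮ b, C_a meets S) ≤ φ_{w₁,q}(a ↮ b) · φ_{w₂,q}(C_a meets S)` for every vertex set `S`. [this work] -/
theorem unwire_set {q : ℝ} (hq : 1 ≤ q) {w₁ w₂ : Sym2 V → unitInterval} {b : V}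
    (h : ∀ e : Sym2 V, b ∉ e → w₁ e ≤ w₂ e) (a : V) (S : Set V) :
    (rcMeasureW w₁ q ∅).real ((⋃ s ∈ S, (openConn a s : Set (BondConfig V))) \ openConn a b) ≤
      (rcMeasureW w₁ q ∅).real (openConn a b : Set (BondConfig V))ᶜ *
        (rcMeasureW w₂ q ∅).real (⋃ s ∈ S, (openConn a s : Set (BondConfig V))) := by
  have hq0 : 0 < q := one_pos.trans_le hq
  set C : Set (BondConfig V) := ⋃ s ∈ S, (openConn a s : Set (BondConfig V)) with hCdef
  set D : Set (BondConfig V) := (openConn a b : Set (BondConfig V))ᶜ with hDdef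
  have hD : ∀ ω, ω ∈ D ↔ ∀ s ∈ ({b} : Set V), ∀ t ∈ ({a} : Set V), ¬ (openGraph ω).Reachable s t := by
    intro ω
    simp only [hDdef, Set.mem_compl_iff, openConn, Set.mem_setOf_eq, Set.mem_singleton_iff,
      forall_eq]
    exact ⟨fun hn hba => hn hba.symm, fun hn hab => hn hab.symm⟩
  set H : Set (Sym2 V) → Set (Sym2 V) → ℝ := fun _ W' =>
    if (∃ s ∈ S, (s ∈ ({a} : Set V) ∨ ∃ e ∈ W', s ∈ e)) then 1 else 0 with hHdef
  have hH' : ∀ (W : Set (Sym2 V)) (η : BondConfig V), H W (setCl η {a}) = ind C η := by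
    intro W η
    by_cases hη : η ∈ C
    · rw [ind_of_mem hη]
      exact if_pos ((reachSet_iff_setCl_singleton η a S).1 hη)
    · rw [ind_of_not_mem hη]
      exact if_neg fun h' => hη ((reachSet_iff_setCl_singleton η a S).2 h')
  have hCD : C \ (openConn a b : Set (BondConfig V)) = C ∩ D := by
    ext ω
    simp only [Set.mem_sdiff, Set.mem_inter_iff, hDdef, Set.mem_compl_iff]
  have key := rc_set_sum_cond_cluster w₁ hq0 {b} {a} H hD
  set γ₂ : ℝ := (rcMeasureW w₂ q ∅).real C with hγ₂
  have hγ₂sum : γ₂ = ∑ η, rcMass w₂ q η * ind C η := rcMeasureW_real_eq_sum_rcMass w₂ hq0 C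
  have hmono : Monotone (ind C) :=
    ind_mono_of_isUpperSet (isUpperSet_iUnion₂ fun s _ => isUpperSet_openConn a s)
  have hinner : ∀ ω : BondConfig V,
      ∑ η, rcMass (delW w₁ (barOf {b} (setCl ω {b}))) q η * H (setCl ω {b}) (setCl η {a}) ≤ γ₂ := by
    intro ω
    simp only [hH']
    rw [hγ₂sum]
    exact sum_rcMass_mono_weights (delW_barOf_le h (setCl ω {b})) hq hmono
  have hL : (rcMeasureW w₁ q ∅).real (C \ openConn a b) =
      ∑ ω, rcMass w₁ q ω * (H (setCl ω {b}) (setCl ω {a}) * ind D ω) := by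
    rw [hCD, rcMeasureW_real_eq_sum_rcMass w₁ hq0]
    refine Finset.sum_congr rfl fun ω _ => ?_
    rw [hH' (setCl ω {b}) ω, ind_inter]
  have hR : (rcMeasureW w₁ q ∅).real D = ∑ ω, rcMass w₁ q ω * ind D ω :=
    rcMeasureW_real_eq_sum_rcMass w₁ hq0 D
  rw [hL, key, hR, Finset.sum_mul]
  refine Finset.sum_le_sum fun ω _ => ?_
  have hm : 0 ≤ rcMass w₁ q ω := rcMass_nonneg w₁ hq0 ω
  have hi : 0 ≤ ind D ω := ind_nonneg D ω
  calc rcMass w₁ q ω * ((∑ η, rcMass (delW w₁ (barOf {b} (setCl ω {b}))) q η *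
          H (setCl ω {b}) (setCl η {a})) * ind D ω)
      ≤ rcMass w₁ q ω * (γ₂ * ind D ω) :=
        mul_le_mul_of_nonneg_left (mul_le_mul_of_nonneg_right (hinner ω) hi) hm
    _ = rcMass w₁ q ω * ind D ω * γ₂ := by ring

/-- **Cross-Harris at a terminal, set form** (`q ≥ 1`; `w₁ = w₂` off the star of `b`; `S` any vertex set):
`φ_{w₁}(a↔b)·φ_{w₂}(a↔S) + φ_{w₂}(a↔b)·φ_{w₁}(a↔S) ≤ φ_{w₁}(a↔b ∧ a↔S) + φ_{w₂}(a↔b ∧ a↔S)` with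
`{a↔S} = ⋃ s ∈ S, {a↔s}` — e.g. the second terminal `c` glued to the set `S` (gen 66's `Cc_X`-type events).
[this work] -/
theorem crossHarris_terminal_rc_set {q : ℝ} (hq : 1 ≤ q) {w₁ w₂ : Sym2 V → unitInterval} {b : V}
    (h : ∀ e : Sym2 V, b ∉ e → w₁ e = w₂ e) (a : V) (S : Set V) :
    (rcMeasureW w₁ q ∅).real (openConn a b : Set (BondConfig V)) *
        (rcMeasureW w₂ q ∅).real (⋃ s ∈ S, (openConn a s : Set (BondConfig V))) +
      (rcMeasureW w₂ q ∅).real (openConn a b : Set (BondConfig V)) *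
        (rcMeasureW w₁ q ∅).real (⋃ s ∈ S, (openConn a s : Set (BondConfig V))) ≤
      (rcMeasureW w₁ q ∅).real ((openConn a b : Set (BondConfig V)) ∩
          ⋃ s ∈ S, (openConn a s : Set (BondConfig V))) +
        (rcMeasureW w₂ q ∅).real ((openConn a b : Set (BondConfig V)) ∩
          ⋃ s ∈ S, (openConn a s : Set (BondConfig V))) := by
  have hq0 : 0 < q := one_pos.trans_le hq
  haveI := isProbabilityMeasure_rcMeasureW w₁ hq0 ∅
  haveI := isProbabilityMeasure_rcMeasureW w₂ hq0 ∅
  set μ₁ := rcMeasureW w₁ q ∅ with hμ₁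
  set μ₂ := rcMeasureW w₂ q ∅ with hμ₂
  set B : Set (BondConfig V) := openConn a b with hB
  set C : Set (BondConfig V) := ⋃ s ∈ S, (openConn a s : Set (BondConfig V)) with hC
  have hmeas : MeasurableSet B := MeasurableSet.of_discrete
  have n1 := unwire_set hq (fun e he => (h e he).le) a S
  have n2 := unwire_set hq (fun e he => (h e he).symm.le) a S
  have c1 : μ₁.real Bᶜ = 1 - μ₁.real B := probReal_compl_eq_one_sub hmeas
  have c2 : μ₂.real Bᶜ = 1 - μ₂.real B := probReal_compl_eq_one_sub hmeas
  have s1 : μ₁.real (C ∩ B) + μ₁.real (C \ B) = μ₁.real C :=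
    measureReal_inter_add_sdiff hmeas (measure_ne_top _ _)
  have s2 : μ₂.real (C ∩ B) + μ₂.real (C \ B) = μ₂.real C :=
    measureReal_inter_add_sdiff hmeas (measure_ne_top _ _)
  rw [Set.inter_comm B C]
  rw [c1] at n1
  rw [c2] at n2
  nlinarith [n1, n2, s1, s2]

end CrossHarrisRC

end Summit.CriticalPhenomena.PercolationContinuityZ3.Theorems
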